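import Literature.AnabelianGeometry.SemiGraphs.TemperedDeltaCompletion
import Literature.AnabelianGeometry.EtaleTheta.DoubleUnderlineTower

/-!
# Normality survives closure of images: `N ⊴ U ⇒ \overline{f(N)} ⊴ \overline{f(U)}`, and the PROFINITE
# normality `Δ̂_X̲̲ ⊴ Δ̂_X̲` of the [EtTh] §2 coverings from the tempered one

Mochizuki, *Semi-graphs of anabelioids* [SemiAnbd], Publ. RIMS **42** (2006), §6 p. 73 ("the `∧` denotes profinite
completion, or, equivalently, closure in `Π_{X_K}`") [cite: MochizukiSemiAnbd2006, §6 p.69]; Mochizuki, *The étale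
theta function …* [EtTh], Publ. RIMS **45** (2009), §2, Prop. 2.2 (ii) PRIMS PDF p. 37 ("the normal subgroup
`Im(s_ι) ⊆ Π̄_X̲`"; "`Δ_X̲̲ = Im(s_ι)`") [cite: MochizukiEtTh2009, Prop 2.2 (ii) p.37]. PROOF-ONLY (0 definitions; cell
abc-iut, layer L2, seat abc-iut-L2-t8; companion of `Discharge/Sec2CompletionIndex.lean`, written for the «completion
transport» of abc-iut-L6-t19's B14 prelims: their TEMPERED `deltaHat_normal`
`((Ξ.Huu ⊓ Δ^tp_X).subgroupOf (GtpXu l ⊓ Δ^tp_X)).Normal` (p422228) ⇒ the PROFINITE one).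

* GENERIC (any group homomorphism `f : F → F'` into a topological group): if `N ≤ U ≤ F` and `N` is normal IN `U`,
  then the closure of `f(N)` is normal IN the closure of `f(U)` — `Subgroup.normal_subgroupOf_topologicalClosure_map`.
  (Conjugation by `f(u)` is a homeomorphism preserving `f(N)`, hence its closure; then for a fixed closed target the
  set of good conjugators is closed and contains `f(U)`, hence its closure.)
* AT THE [EtTh] §1 MODEL along abc-iut-L3's `TemperedCurve.deltaToHat : Δ^tp_X → Δ_X`: from the tempered normality
  of `Δ^tp_X̲̲ = Π^tp_X̲̲ ∩ Δ^tp_X` in `Δ^tp_X̲ = Π^tp_X̲ ∩ Δ^tp_X` (a HYPOTHESIS here — for abc-iut-L2-t7's cocycle model it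
  is abc-iut-L6-t19's theorem; for the abstract `DoubleUnderline` it is not derivable, cf. STATUS 2026-08-26 04:2xZ)
  to **`DoubleUnderline.normal_closure_deltaXuu_subgroupOf_closure_deltaXu`**: `Δ̂_X̲̲ ⊴ Δ̂_X̲` for the closures in `Δ_X`.

Honest framing: classical topological group theory; structures are data quoting print; no side is taken on
[IUTchIII] Cor. 3.12.
-/

noncomputable section

/-- **Normality survives closure of images.** For a group homomorphism `f : F → F'` into a topological group and
subgroups `N ≤ U` of `F` with `N` normal in `U`, the closure of `f(N)` is normal in the closure of `f(U)`.
[cite: MochizukiSemiAnbd2006, §6 p.69] -/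
theorem Subgroup.normal_subgroupOf_topologicalClosure_map {F F' : Type*} [Group F] [Group F']
    [TopologicalSpace F'] [IsTopologicalGroup F'] (f : F →* F') {N U : Subgroup F} (hNU : N ≤ U)
    (hN : (N.subgroupOf U).Normal) :
    (((N.map f).topologicalClosure).subgroupOf ((U.map f).topologicalClosure)).Normal := by
  set A : Subgroup F' := (N.map f).topologicalClosure with hA
  set B : Subgroup F' := (U.map f).topologicalClosure with hB
  have hAclosed : IsClosed (A : Set F') := Subgroup.isClosed_topologicalClosure _
  -- Step 1: `f(u)` normalises `A` for `u ∈ U`.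
  have step1 : ∀ u ∈ U, ∀ a ∈ A, f u * a * (f u)⁻¹ ∈ A := by
    intro u hu a ha
    -- `A ≤ comap (conj (f u)) A`, a closed subgroup containing `f(N)`
    let c : F' →* F' := (MulAut.conj (f u)).toMonoidHom
    have hc : Continuous c := (continuous_const.mul continuous_id).mul continuous_const
    have hle : N.map f ≤ A.comap c := by
      rintro _ ⟨n, hn, rfl⟩
      rw [Subgroup.mem_comap]
      change f u * f n * (f u)⁻¹ ∈ A
      rw [← map_mul, ← map_inv, ← map_mul]
      refine Subgroup.le_topologicalClosure _ ⟨u * n * u⁻¹, ?_, rfl⟩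
      have h := hN.conj_mem ⟨n, hNU hn⟩ (Subgroup.mem_subgroupOf.mpr hn) ⟨u, hu⟩
      exact Subgroup.mem_subgroupOf.mp h
    have hclosed : IsClosed ((A.comap c : Subgroup F') : Set F') := hAclosed.preimage hc
    have := (Subgroup.topologicalClosure_minimal _ hle hclosed) ha
    exact this
  -- Step 2: the set of `g` conjugating `A` into `A` is closed and contains `f(U)`, hence `B`.
  have step2 : ∀ b ∈ B, ∀ a ∈ A, b * a * b⁻¹ ∈ A := by
    intro b hb
    have hT : IsClosed {g : F' | ∀ a ∈ A, g * a * g⁻¹ ∈ A} := by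
      have : {g : F' | ∀ a ∈ A, g * a * g⁻¹ ∈ A} = ⋂ a ∈ A, (fun g : F' => g * a * g⁻¹) ⁻¹' (A : Set F') := by
        ext g; simp
      rw [this]
      exact isClosed_biInter fun a _ =>
        hAclosed.preimage ((continuous_id.mul continuous_const).mul continuous_id.inv)
    have hsub : ((U.map f : Subgroup F') : Set F') ⊆ {g : F' | ∀ a ∈ A, g * a * g⁻¹ ∈ A} := by
      rintro _ ⟨u, hu, rfl⟩
      exact step1 u hu
    have hb' : b ∈ _root_.closure ((U.map f : Subgroup F') : Set F') := by
      rw [← Subgroup.topologicalClosure_coe]; exact hb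
    exact _root_.closure_minimal hsub hT hb'
  refine ⟨fun a ha b => ?_⟩
  rw [Subgroup.mem_subgroupOf] at ha ⊢
  exact step2 b b.2 a ha

namespace Literature.AnabelianGeometry.EtaleTheta

open Literature.AnabelianGeometry.SemiGraphs

namespace ThetaSetting

variable {p : ℕ} [Fact p.Prime] {D : ThetaSetting p}

/-- Reading a relative normality between subgroups of `Δ^tp_X` inside the subtype group `↥Δ^tp_X`:
`(A ∩ Δ) ⊴ (B ∩ Δ)` (subgroups of `Π^tp_X`) gives `(A|_Δ) ⊴ (B|_Δ)` (subgroups of `↥Δ`).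
[cite: MochizukiEtTh2009, Prop 2.2 (ii) p.37] -/
theorem normal_subgroupOf_subgroupOf_deltaTemp {A B : Subgroup D.PiTemp}
    (h : ((A ⊓ D.DeltaTemp).subgroupOf (B ⊓ D.DeltaTemp)).Normal) :
    ((A.subgroupOf D.DeltaTemp).subgroupOf (B.subgroupOf D.DeltaTemp)).Normal := by
  refine ⟨fun a ha b => ?_⟩
  rw [Subgroup.mem_subgroupOf, Subgroup.mem_subgroupOf] at ha ⊢
  have hb : ((b : D.DeltaTemp) : D.PiTemp) ∈ B ⊓ D.DeltaTemp :=
    Subgroup.mem_inf.mpr ⟨Subgroup.mem_subgroupOf.mp b.2, (b : D.DeltaTemp).2⟩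
  have ha' : ((a : D.DeltaTemp) : D.PiTemp) ∈ B ⊓ D.DeltaTemp :=
    Subgroup.mem_inf.mpr ⟨Subgroup.mem_subgroupOf.mp a.2, (a : D.DeltaTemp).2⟩
  have key := h.conj_mem ⟨_, ha'⟩
    (Subgroup.mem_subgroupOf.mpr (Subgroup.mem_inf.mpr ⟨ha, (a : D.DeltaTemp).2⟩)) ⟨_, hb⟩
  rw [Subgroup.mem_subgroupOf] at key
  exact (Subgroup.mem_inf.mp key).1

namespace EtaleThetaData.DoubleUnderline

variable {E : D.EtaleThetaData} {l : ℕ} (C : E.DoubleUnderline l)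

/-- **`Δ̂_X̲̲ ⊴ Δ̂_X̲` (profinite) from `Δ^tp_X̲̲ ⊴ Δ^tp_X̲` (tempered).** If `Δ^tp_X̲̲ = Π^tp_X̲̲ ∩ Δ^tp_X` is normal in
`Δ^tp_X̲ = Π^tp_X̲ ∩ Δ^tp_X` ("the normal subgroup `Im(s_ι)`", Prop. 2.2 (ii) — a hypothesis here: a theorem for
abc-iut-L2-t7's cocycle model of `X̲̲` by abc-iut-L6-t19's p422228, not derivable for the abstract `DoubleUnderline`), then
the closure in `Δ_X` of the image of `Δ^tp_X̲̲` under `Δ^tp_X → Δ_X` is normal in that of `Δ^tp_X̲`.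
[cite: MochizukiEtTh2009, Prop 2.2 (ii) p.37] -/
theorem normal_closure_deltaXuu_subgroupOf_closure_deltaXu
    (hN : ((C.Huu ⊓ D.DeltaTemp).subgroupOf (D.GtpXu l ⊓ D.DeltaTemp)).Normal) :
    ((((C.Huu.subgroupOf D.DeltaTemp).map D.toTemperedCurve.deltaToHat.toMonoidHom).topologicalClosure).subgroupOf
      ((((D.GtpXu l).subgroupOf D.DeltaTemp).map D.toTemperedCurve.deltaToHat.toMonoidHom).topologicalClosure)).Normal :=
  Subgroup.normal_subgroupOf_topologicalClosure_map D.toTemperedCurve.deltaToHat.toMonoidHom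
    (fun _ hx => C.Huu_le_GtpXu hx) (normal_subgroupOf_subgroupOf_deltaTemp hN)

end EtaleThetaData.DoubleUnderline

end ThetaSetting

end Literature.AnabelianGeometry.EtaleTheta
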